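import Literature.NumberTheory.EllipticCurves.GaussSumSign
import Literature.NumberTheory.EllipticCurves.HalfIntegralWeightGaussSumsOdd
import Literature.NumberTheory.QuadraticFields.JacobiCharacterPrimitiveProofs
import Mathlib.NumberTheory.DirichletCharacter.GaussSum
import HarnessLib

/-!
# The Gauss sum of the Jacobi character `(·/D)`, `D` odd square-free, with its sign

[[cite: MontgomeryVaughan2007, §9.3, Thm. 9.17]] (Gauss: for the primitive quadratic character
`χ_d = (d/·)`, `τ(χ_d) = √d` if `d > 0` and `= i√(-d)` if `d < 0`; for an odd square-free `D` the
Jacobi character `(·/D)` is `χ_D` (`D ≡ 1 (mod 4)`) resp. `χ_{-D}` (`D ≡ 3 (mod 4)`), so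
`τ((·/D)) = √D` resp. `i√D`) — the tree
has Gauss's evaluation WITH SIGN of the quadratic exponential sum `G(1; D) = ∑_{r mod D} e(r²/D)`
for every odd `D` (`quadGaussSum_one_of_mod_four_eq_one/three`, file `GaussSumSign`, from the theta
multiplier) and the prime case of the character sum (`legendreGaussSum_eq`).  Here we pass from the
exponential sum to the CHARACTER sum `τ(χ_D) = ∑_{a mod D} (a/D) e(a/D)` (Mathlib `gaussSum` of the
tree's `QuadraticFields.jacobiChar D` against `ZMod.stdAddChar`) for every odd square-free `D`, by
evaluating `∑_{a mod D} (a/D) G(a; D)` in two ways: termwise `G(a; D) = (a/D) G(1; D)` for units `a`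
(`quadGaussSum_eq_jacobiSym_mul`) gives `φ(D) G(1; D)`, while opening `G(a; D) = ∑_r e(ar²/D)` and
summing over `a` first gives `∑_r τ(χ_D, e(r²·/D)) = ∑_r χ_D(r²) τ(χ_D) = φ(D) τ(χ_D)` (primitivity:
Mathlib `gaussSum_mulShift_of_isPrimitive`, `isPrimitive_jacobiChar`).  Hence
**`gaussSum_jacobiChar_eq_quadGaussSum`** (`τ(χ_D) = G(1; D)`) and Gauss's theorem for `χ_D`:
**`gaussSum_jacobiChar_of_mod_four_eq_one`** (`= √D`), **`gaussSum_jacobiChar_of_mod_four_eq_three`**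
(`= i√D`).  This is the constant in Birch's
formula `τ(χ_D) L(E_D, 1) = ∑ χ_D(a){∞, a/D}` that makes the diagonal Shintani coefficient a FIXED
multiple of `L(E_D, 1)√D` on each class of `D mod 4` (route to
`Literature.NumberTheory.EllipticCurves.Tunnell1983_a_sq_propto_L_one`).

No named facts, no definitions.
-/

noncomputable section

open Complex Finset
open scoped NumberTheorySymbols

namespace Literature.NumberTheory.EllipticCurves.ModularForms

open Literature.NumberTheory.QuadraticFields

variable {D : ℕ} [NeZero D]

/-- `(a/D) G(a; D) = (a/D)² G(1; D)` for every residue `a` (`D` odd): for units this is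
`G(a; D) = (a/D) G(1; D)`, for non-units both sides vanish. [folklore] -/
theorem jacobiChar_mul_quadGaussSum (hodd : Odd D) (a : ZMod D) :
    jacobiChar D a * quadGaussSum D a 0 = jacobiChar D a ^ 2 * quadGaussSum D 1 0 := by
  by_cases ha : IsUnit a
  · have hu : IsUnit ((a.val : ℕ) : ZMod D) := by rwa [ZMod.natCast_zmod_val]
    have hcop : (a.val : ℤ).gcd (D : ℤ) = 1 := by
      rw [Int.gcd_natCast_natCast]
      exact (ZMod.isUnit_iff_coprime _ _).mp hu
    have h := quadGaussSum_eq_jacobiSym_mul hodd hcop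
    rw [Int.cast_natCast, ZMod.natCast_zmod_val] at h
    rw [h, jacobiChar_apply, sq]
    ring
  · rw [MulChar.map_nonunit _ ha]
    simp

/-- `∑_a (a/D) G(a; D) = (∑_r (r/D)²) · τ(χ_D)` (`D` odd square-free): open `G(a; D) = ∑_r e(ar²/D)`,
sum over `a` first, and use `∑_a χ(a) e(a m/D) = χ̄(m) τ(χ)` for the primitive `χ = χ_D`. [folklore] -/
theorem sum_jacobiChar_mul_quadGaussSum (hodd : Odd D) (hsq : Squarefree D) :
    ∑ a : ZMod D, jacobiChar D a * quadGaussSum D a 0 =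
      (∑ r : ZMod D, jacobiChar D r ^ 2) * gaussSum (jacobiChar D) (ZMod.stdAddChar (N := D)) := by
  have hprim := isPrimitive_jacobiChar hodd hsq
  have hquad := isQuadratic_jacobiChar (q := D)
  calc ∑ a : ZMod D, jacobiChar D a * quadGaussSum D a 0
      = ∑ a : ZMod D, ∑ r : ZMod D, jacobiChar D a * (ZMod.stdAddChar (a * r ^ 2) : ℂ) := by
        refine sum_congr rfl fun a _ ↦ ?_
        rw [quadGaussSum_def, mul_sum]
        refine sum_congr rfl fun r _ ↦ ?_
        rw [zero_mul, add_zero]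
    _ = ∑ r : ZMod D, ∑ a : ZMod D, jacobiChar D a * (ZMod.stdAddChar (a * r ^ 2) : ℂ) := sum_comm
    _ = ∑ r : ZMod D, gaussSum (jacobiChar D) ((ZMod.stdAddChar (N := D)).mulShift (r ^ 2)) := by
        refine sum_congr rfl fun r _ ↦ ?_
        rw [gaussSum]
        refine sum_congr rfl fun a _ ↦ ?_
        rw [AddChar.mulShift_apply, mul_comm (r ^ 2) a]
    _ = ∑ r : ZMod D, jacobiChar D r ^ 2 * gaussSum (jacobiChar D) (ZMod.stdAddChar (N := D)) := by
        refine sum_congr rfl fun r _ ↦ ?_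
        rw [gaussSum_mulShift_of_isPrimitive _ hprim, hquad.inv, map_pow]
    _ = _ := by rw [sum_mul]

/-- `∑_r (r/D)² = φ(D) ≠ 0`. [folklore] -/
theorem sum_jacobiChar_sq_ne_zero : (∑ r : ZMod D, jacobiChar D r ^ 2) ≠ 0 := by
  have h : ∀ r : ZMod D, jacobiChar D r ^ 2 = if IsUnit r then 1 else 0 := by
    intro r
    split_ifs with hr
    · rcases jacobiChar_trichotomy r with h0 | h1 | h1
      · exact absurd h0 (hr.map (jacobiChar D)).ne_zero
      · rw [h1]; norm_num
      · rw [h1]; norm_num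
    · rw [MulChar.map_nonunit _ hr]
      simp
  simp_rw [h, sum_boole]
  have h1 : (1 : ZMod D) ∈ univ.filter (fun r : ZMod D ↦ IsUnit r) := by simp
  exact_mod_cast (card_pos.mpr ⟨1, h1⟩).ne'

/-- **`τ(χ_D) = G(1; D)`**: the Gauss sum of the Jacobi character `(·/D)` equals the quadratic
exponential sum `∑_{r mod D} e(r²/D)`, for every odd square-free `D`. [cite: MontgomeryVaughan2007, §9.3, Thm. 9.17] -/
theorem gaussSum_jacobiChar_eq_quadGaussSum (hodd : Odd D) (hsq : Squarefree D) :
    gaussSum (jacobiChar D) (ZMod.stdAddChar (N := D)) = quadGaussSum D 1 0 := by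
  have h1 : ∑ a : ZMod D, jacobiChar D a * quadGaussSum D a 0 =
      (∑ r : ZMod D, jacobiChar D r ^ 2) * quadGaussSum D 1 0 := by
    rw [sum_mul]
    exact sum_congr rfl fun a _ ↦ jacobiChar_mul_quadGaussSum hodd a
  exact mul_left_cancel₀ sum_jacobiChar_sq_ne_zero
    ((sum_jacobiChar_mul_quadGaussSum hodd hsq).symm.trans h1)

/-- **Gauss's theorem for `χ_D`, `D ≡ 1 (mod 4)` square-free: `τ(χ_D) = √D`.**
[cite: MontgomeryVaughan2007, §9.3, Thm. 9.17] -/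
theorem gaussSum_jacobiChar_of_mod_four_eq_one (hsq : Squarefree D) (hD : D % 4 = 1) :
    gaussSum (jacobiChar D) (ZMod.stdAddChar (N := D)) = (Real.sqrt D : ℂ) := by
  rw [gaussSum_jacobiChar_eq_quadGaussSum (Nat.odd_iff.mpr (by omega)) hsq,
    quadGaussSum_one_of_mod_four_eq_one hD]

/-- **Gauss's theorem for `χ_D`, `D ≡ 3 (mod 4)` square-free: `τ(χ_D) = i√D`.**
[cite: MontgomeryVaughan2007, §9.3, Thm. 9.17] -/
theorem gaussSum_jacobiChar_of_mod_four_eq_three (hsq : Squarefree D) (hD : D % 4 = 3) :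
    gaussSum (jacobiChar D) (ZMod.stdAddChar (N := D)) = I * (Real.sqrt D : ℂ) := by
  rw [gaussSum_jacobiChar_eq_quadGaussSum (Nat.odd_iff.mpr (by omega)) hsq,
    quadGaussSum_one_of_mod_four_eq_three hD]

/-- In particular `τ(χ_D)² = χ_D(-1) D` is refined to `τ(χ_D)/√D ∈ {1, i}`; the square-free odd
`D ≡ 1 (mod 4)` case `τ(χ_D)/√D = 1` in the form used for Birch's formula. [folklore] -/
theorem gaussSum_jacobiChar_div_sqrt_of_mod_four_eq_one (hsq : Squarefree D) (hD : D % 4 = 1) :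
    gaussSum (jacobiChar D) (ZMod.stdAddChar (N := D)) / (Real.sqrt D : ℂ) = 1 := by
  rw [gaussSum_jacobiChar_of_mod_four_eq_one hsq hD]
  have : (Real.sqrt D : ℂ) ≠ 0 := by
    have hD0 : (0 : ℝ) < D := by exact_mod_cast Nat.pos_of_ne_zero (NeZero.ne D)
    exact_mod_cast (Real.sqrt_pos.mpr hD0).ne'
  exact div_self this

end Literature.NumberTheory.EllipticCurves.ModularForms
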